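import Summits.QuantumFields.YangMills.Theorems.UnitScaleTiltProp7TopMeanTwoBackgrounds
import Summits.QuantumFields.YangMills.Theorems.UnitScaleTiltProp7TopMeanFrameRows
import HarnessLib

/-!
# Route `UnitScaleTilt`, crux K1 «MinimiserStabilityRegPr» (stmt-QuantumFields-19200), EX row `hGF[Lift]` (curved member) — **LOD LINE, PEN (L5″) (RB2) MEMBER KNIT:
# THE TWO TOP MEANS ON A PROPAGATED VECTOR** — the row `hRB2 : ‖S_W(G_1 h) − S_1(G_1 h)‖ ≤ c_Q‖h‖` of routeR-w3 g12's 2b-door ✓`Prop7ColumnPairingRows.sqrt_sum_normSq_inner_column_sub_le`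
at the member `S = ι ∘ Q″`, from the δ_Q supplier ✓`Prop7TopMeanTwoBackgrounds` (px5 (M-III)) and the frame rows ✓`Prop7TopMeanFrameRows` (px5 (M-III′)): split the propagated field
`u` (`toL2S u = G_1 h`) by a fattened cut-off `χ̃` (`|χ̃| ≤ 1`), compare the two means on `χ̃·u` (near part, (M-III) `norm_lift_topMean_sub_le`) and bound both means on the tail
`(1 − χ̃)·u` by ✓`normSq_lift_topMean_le` (far part); the tail size `τ` (Agmon, ✓`Prop7MassivePropagatorAgmon.agmon_rows_exp`) and `‖toL2S u‖ ≤ ‖G_1‖‖h‖` are the consumer's two numbers.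

Cell `ym3-torus` (HUMAN RULING D-0037, YM ladder rung R3 — NOT d = 4, NOT infinite volume, NOT a mass gap, NOT Clay).  Width seat `ym3-torus-px5` gen 11; ★p1 g24 LOCATE-L6-ASSEMBLY
§1 Step I.2 (L5″), road (α); routeR-w3 g12 2026-08-30 00:44:48Z (RB1)∕(RB2).  THEOREMS ONLY (0 `def`, 0 `sorry`); `--supports stmt-QuantumFields-19200 --as helper`, count-neutral.
HONEST LABEL (★★OWNER RULING №33 (6)): curved γ-row supplier line (LOD localisation), pen (L5″); a knit of landed rows — displayed data: the frame∕walk-flatness rows on the blocks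
meeting `supp χ̃` and the tail number `τ`; nothing of (3.49), Thm 3.1∕3.3, `h349`, `hGF`, EX ∕ 19200 is proved here.

References: T. Bałaban, CMP **99** (1985) 389–434 [Balaban1985BackgroundPropagators] ((3.16), (3.19) p.393, (3.21), (3.24) p.394, (3.49) p.399); CMP **98** (1985) 17–51
[Balaban1985Averaging] ((19)–(20) p.21, (97) p.32).
-/

set_option autoImplicit false

noncomputable section

open scoped BigOperators Matrix.Norms.L2Operator InnerProductSpace ComplexConjugate

namespace Summit.QuantumFields.YangMills.Theorems.Prop7TopMeanComparisonOnPropagator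

open Literature.MathematicalPhysics.QuantumFieldTheory.Balaban1983to89
open T4Continuum BlockAveraging
open BlockAveraging (Idx)
open B7Prop1Explicit (U1 treeWord l1 disp)
open B5Eq118OneStroke (iterBlockOf iterBlock)
open B15DeterminingSets (embIter)
open B10Eq27TorusAxialLog (holT axialT rel transl)
open B7TransferAnalyticMean (meanCLM)
open B11Eq103H1Complex (SiteL2K)
open Summit.QuantumFields.YangMills.Theorems.Prop8Chart (emlIterU)
open Literature.MathematicalPhysics.QuantumFieldTheory.Balaban1983to89.T3ContinuumYM3Torus
open T3SectALandauChart (bgUnits)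
open T3PrintedRegularMinimiser (RegPr)
open T3PrintedRegularOrbits (sites_eq)
open T3LevelShift (siteShift)
open Summit.QuantumFields.YangMills.Theorems.Prop7SectET3Transport (periodsT3)
open Summit.QuantumFields.YangMills.Theorems.Prop7SectET3HilbertLetters (W₂ toL2S)
open Summit.QuantumFields.YangMills.Theorems.Prop7MassivePropagatorAgmonLetters (normSq_lift_topMean_le norm_toL2S_smul_le)
open Summit.QuantumFields.YangMills.Theorems.Prop7TopMeanTwoBackgrounds (norm_lift_topMean_sub_le)
open Summit.QuantumFields.YangMills.Theorems.Prop7TopMeanFrameRows (frameRow_one frameRow_of_walkFlat)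

variable (F : T3Family) {n K : ℕ} {c₀ : ℝ} [Fact (0 < c₀)] {ε₀ : ℝ} (hε₀ : 0 < ε₀) (hε7 : 10 ^ 7 * (F.L : ℝ) ^ 3 * ε₀ ≤ 1)
  (V : GaugeField (F.P K) 0 (Matrix.specialUnitaryGroup (Fin 2) ℂ)) (hreg : RegPr F n K ε₀ V)
  (Q'' : SiteL2K ℂ 3 (periodsT3 F K) c₀ W₂ →ₗ[ℂ] (Site (F.P K) (K - n) → Matrix (Fin 2) (Fin 2) ℂ))
  (hseq : ∀ lam : Site (F.P K) 0 → Matrix (Fin 2) (Fin 2) ℂ, ∃ ns : (j : ℕ) → Site (F.P K) j → Matrix (Fin 2) (Fin 2) ℂ, ns 0 = lam ∧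
        (∀ (j : ℕ) (y : Site (F.P K) (j + 1)), ns (j + 1) y = ns j (emb y) - meanCLM (Idx (F.P K)) (Matrix (Fin 2) (Fin 2) ℂ) fun i : Idx (F.P K) =>
          ns j (emb y) - ((holT (emlIterU j (bgUnits F K V)) (emb y) (stairWord i.2.1 (off i.1)) : (Matrix (Fin 2) (Fin 2) ℂ)ˣ) : Matrix (Fin 2) (Fin 2) ℂ) *
            ns j (transl (emb y) (disp (stairWord i.2.1 (off i.1)))) * (((holT (emlIterU j (bgUnits F K V)) (emb y) (stairWord i.2.1 (off i.1)))⁻¹ : (Matrix (Fin 2) (Fin 2) ℂ)ˣ) : Matrix (Fin 2) (Fin 2) ℂ)) ∧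
        ns (K - n) = Q'' (toL2S F K c₀ lam))
  (U : GaugeField (F.P K) 0 (Matrix.specialUnitaryGroup (Fin 2) ℂ)) (hregU : RegPr F n K ε₀ U)
  (QU : SiteL2K ℂ 3 (periodsT3 F K) c₀ W₂ →ₗ[ℂ] (Site (F.P K) (K - n) → Matrix (Fin 2) (Fin 2) ℂ))
  (hseqU : ∀ lam : Site (F.P K) 0 → Matrix (Fin 2) (Fin 2) ℂ, ∃ ns : (j : ℕ) → Site (F.P K) j → Matrix (Fin 2) (Fin 2) ℂ, ns 0 = lam ∧
        (∀ (j : ℕ) (y : Site (F.P K) (j + 1)), ns (j + 1) y = ns j (emb y) - meanCLM (Idx (F.P K)) (Matrix (Fin 2) (Fin 2) ℂ) fun i : Idx (F.P K) =>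
          ns j (emb y) - ((holT (emlIterU j (bgUnits F K U)) (emb y) (stairWord i.2.1 (off i.1)) : (Matrix (Fin 2) (Fin 2) ℂ)ˣ) : Matrix (Fin 2) (Fin 2) ℂ) *
            ns j (transl (emb y) (disp (stairWord i.2.1 (off i.1)))) * (((holT (emlIterU j (bgUnits F K U)) (emb y) (stairWord i.2.1 (off i.1)))⁻¹ : (Matrix (Fin 2) (Fin 2) ℂ)ˣ) : Matrix (Fin 2) (Fin 2) ℂ)) ∧
        ns (K - n) = QU (toL2S F K c₀ lam))
  (h : n ≤ K) {c₁ : ℝ} [Fact (0 < c₁)]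
  (ι : (Site (F.P K) (K - n) → Matrix (Fin 2) (Fin 2) ℂ) →ₗ[ℂ] SiteL2K ℂ 3 (periodsT3 F n) c₁ W₂)
  (hι : ∀ c, ι c = toL2S F n c₁ (fun z => c (siteShift (sites_eq F n K h) z)))

include hε₀ hε7 hreg hseq hregU hseqU hι in
/-- ★★ **A LIFTED TOP MEAN OF RECORD IS BOUNDED ON A TAIL**: `‖ι(Q''(toL2S y))‖ ≤ √(25κ∕8)·‖toL2S y‖` (✓`normSq_lift_topMean_le`, square roots), `κ = c₁((L^d)^{K−n})⁻¹∕c₀`.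
[cite: Balaban1985BackgroundPropagators, (3.16) p.393, (3.24) p.394; Balaban1985Averaging, (97) p.32] -/
theorem norm_lift_topMean_le (y : Site (F.P K) 0 → Matrix (Fin 2) (Fin 2) ℂ) :
    ‖ι (Q'' (toL2S F K c₀ y))‖ ≤ Real.sqrt ((25 / 8) * (c₁ * ((((F.P K).L : ℝ) ^ (F.P K).d) ^ (K - n))⁻¹ / c₀)) * ‖toL2S F K c₀ y‖ ∧
      ‖ι (QU (toL2S F K c₀ y))‖ ≤ Real.sqrt ((25 / 8) * (c₁ * ((((F.P K).L : ℝ) ^ (F.P K).d) ^ (K - n))⁻¹ / c₀)) * ‖toL2S F K c₀ y‖ := by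
  have hc₀ : 0 < c₀ := Fact.out
  have hc₁ : 0 < c₁ := Fact.out
  have hκ0 : 0 ≤ (c₁ * ((((F.P K).L : ℝ) ^ (F.P K).d) ^ (K - n))⁻¹ / c₀) := by have := (F.P K).L_pos; positivity
  have h0 : 0 ≤ Real.sqrt ((25 / 8) * (c₁ * ((((F.P K).L : ℝ) ^ (F.P K).d) ^ (K - n))⁻¹ / c₀)) * ‖toL2S F K c₀ y‖ := by positivity
  have key : ∀ s : ℝ, 0 ≤ s → s ^ 2 ≤ (25 / 8) * (c₁ * ((((F.P K).L : ℝ) ^ (F.P K).d) ^ (K - n))⁻¹ / c₀) * ‖toL2S F K c₀ y‖ ^ 2 → s ≤ Real.sqrt ((25 / 8) * (c₁ * ((((F.P K).L : ℝ) ^ (F.P K).d) ^ (K - n))⁻¹ / c₀)) * ‖toL2S F K c₀ y‖ := by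
    intro s hs hs2
    have e : (Real.sqrt ((25 / 8) * (c₁ * ((((F.P K).L : ℝ) ^ (F.P K).d) ^ (K - n))⁻¹ / c₀)) * ‖toL2S F K c₀ y‖) ^ 2 = (25 / 8) * (c₁ * ((((F.P K).L : ℝ) ^ (F.P K).d) ^ (K - n))⁻¹ / c₀) * ‖toL2S F K c₀ y‖ ^ 2 := by
      rw [mul_pow, Real.sq_sqrt (by positivity)]
    have := Real.sqrt_le_sqrt (hs2.trans_eq e.symm)
    rwa [Real.sqrt_sq hs, Real.sqrt_sq h0] at this
  refine ⟨key _ (norm_nonneg _) ?_, key _ (norm_nonneg _) ?_⟩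
  · rw [hι]; exact normSq_lift_topMean_le F V Q'' hseq h (c₁ := c₁) hε₀ hε7 hreg y
  · rw [hι]; exact normSq_lift_topMean_le F U QU hseqU h (c₁ := c₁) hε₀ hε7 hregU y

include hε₀ hε7 hreg hseq hregU hseqU hι in
/-- ★★★ **(RB2) MEMBER KNIT — THE TWO LIFTED TOP MEANS ON A PROPAGATED FIELD**: for a real fattened cut-off `χ̃` with `|χ̃| ≤ 1`, frame rows `‖C^V − 1‖ ≤ δ_V`, `‖C^U − 1‖ ≤ δ_U` on
the blocks meeting `supp χ̃` (`0 ≤ δ_V, δ_U`), and any field `u` (the consumer's `toL2S u = G_1 h`) whose tail off the plateau is small, `‖toL2S((1 − χ̃)·u)‖ ≤ τ`: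
`‖ι(QU(toL2S u)) − ι(Q''(toL2S u))‖ ≤ √(2κ)·(9000L²ε₀ + 2δ_V + 2δ_U)·‖toL2S u‖ + 2·√(25κ∕8)·τ` (near part: (M-III) ✓`norm_lift_topMean_sub_le` on `χ̃·u`; far part: both lifted
means of `(1 − χ̃)·u` by ✓`norm_lift_topMean_le`).  With `‖toL2S u‖ ≤ ‖G_1‖‖h‖` and the Agmon tail `τ ≤ τ′‖h‖` this is 2b-door's `hRB2` with `c_Q = √(2κ)(9000L²ε₀ + 2δ_V + 2δ_U)‖G_1‖ + 2√(25κ∕8)τ′`.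
[cite: Balaban1985BackgroundPropagators, (3.16), (3.19) p.393, (3.21), (3.24) p.394; Balaban1985Averaging, (97) p.32] -/
theorem norm_lift_topMean_sub_le_of_tail (χt : Site (F.P K) 0 → ℝ) (hχ1 : ∀ x, |χt x| ≤ 1) {δV δU : ℝ} (hδV : 0 ≤ δV) (hδU : 0 ≤ δU)
    (hCV : ∀ Y : Site (F.P K) (K - n), (∃ x ∈ iterBlock (K - n) Y, χt x ≠ 0) → ∀ x ∈ iterBlock (K - n) Y, ‖(((axialT (bgUnits F K V) (Site.fibreSite 0 (K - n) (iterBlockOf (K - n) x) fun _ => (⟨0, pow_pos (F.P K).L_pos (K - n)⟩ : Fin ((F.P K).L ^ (K - n)))) (embIter (K - n) Y))⁻¹ *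
          axialT (bgUnits F K V) (Site.fibreSite 0 (K - n) (iterBlockOf (K - n) x) fun _ => (⟨0, pow_pos (F.P K).L_pos (K - n)⟩ : Fin ((F.P K).L ^ (K - n)))) x : (Matrix (Fin 2) (Fin 2) ℂ)ˣ) : Matrix (Fin 2) (Fin 2) ℂ) - 1‖ ≤ δV)
    (hCU : ∀ Y : Site (F.P K) (K - n), (∃ x ∈ iterBlock (K - n) Y, χt x ≠ 0) → ∀ x ∈ iterBlock (K - n) Y, ‖(((axialT (bgUnits F K U) (Site.fibreSite 0 (K - n) (iterBlockOf (K - n) x) fun _ => (⟨0, pow_pos (F.P K).L_pos (K - n)⟩ : Fin ((F.P K).L ^ (K - n)))) (embIter (K - n) Y))⁻¹ *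
          axialT (bgUnits F K U) (Site.fibreSite 0 (K - n) (iterBlockOf (K - n) x) fun _ => (⟨0, pow_pos (F.P K).L_pos (K - n)⟩ : Fin ((F.P K).L ^ (K - n)))) x : (Matrix (Fin 2) (Fin 2) ℂ)ˣ) : Matrix (Fin 2) (Fin 2) ℂ) - 1‖ ≤ δU)
    (u : Site (F.P K) 0 → Matrix (Fin 2) (Fin 2) ℂ) {τ : ℝ} (htail : ‖toL2S F K c₀ (fun x => (1 - χt x) • u x)‖ ≤ τ) :
    ‖ι (QU (toL2S F K c₀ u)) - ι (Q'' (toL2S F K c₀ u))‖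
      ≤ Real.sqrt (2 * (c₁ * ((((F.P K).L : ℝ) ^ (F.P K).d) ^ (K - n))⁻¹ / c₀)) * (2 * (4500 * (F.L : ℝ) ^ 2 * ε₀) + 2 * δV + 2 * δU) * ‖toL2S F K c₀ u‖
        + 2 * Real.sqrt ((25 / 8) * (c₁ * ((((F.P K).L : ℝ) ^ (F.P K).d) ^ (K - n))⁻¹ / c₀)) * τ := by
  have hc₀ : 0 < c₀ := Fact.out
  have hc₁ : 0 < c₁ := Fact.out
  -- `u = χ̃·u + (1 − χ̃)·u`
  have hsplit : toL2S F K c₀ u = toL2S F K c₀ (fun x => χt x • u x) + toL2S F K c₀ (fun x => (1 - χt x) • u x) := by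
    rw [← map_add]; congr 1; funext x
    rw [Pi.add_apply, ← add_smul, add_sub_cancel, one_smul]
  have hnear := norm_lift_topMean_sub_le F hε₀ hε7 V hreg Q'' hseq U hregU QU hseqU h ι hι χt hχ1 hδV hδU hCV hCU u
  obtain ⟨hfarV, hfarU⟩ := norm_lift_topMean_le F hε₀ hε7 V hreg Q'' hseq U hregU QU hseqU h ι hι (fun x => (1 - χt x) • u x)
  have hκ0 : 0 ≤ Real.sqrt ((25 / 8) * (c₁ * ((((F.P K).L : ℝ) ^ (F.P K).d) ^ (K - n))⁻¹ / c₀)) := Real.sqrt_nonneg _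
  have e : ι (QU (toL2S F K c₀ u)) - ι (Q'' (toL2S F K c₀ u))
      = -(ι (Q'' (toL2S F K c₀ fun x => χt x • u x)) - ι (QU (toL2S F K c₀ fun x => χt x • u x)))
        + (ι (QU (toL2S F K c₀ fun x => (1 - χt x) • u x)) - ι (Q'' (toL2S F K c₀ fun x => (1 - χt x) • u x))) := by
    rw [hsplit, map_add, map_add, map_add, map_add]; abel
  rw [e]
  calc _ ≤ ‖-(ι (Q'' (toL2S F K c₀ fun x => χt x • u x)) - ι (QU (toL2S F K c₀ fun x => χt x • u x)))‖
        + ‖ι (QU (toL2S F K c₀ fun x => (1 - χt x) • u x)) - ι (Q'' (toL2S F K c₀ fun x => (1 - χt x) • u x))‖ := norm_add_le _ _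
    _ ≤ Real.sqrt (2 * (c₁ * ((((F.P K).L : ℝ) ^ (F.P K).d) ^ (K - n))⁻¹ / c₀)) * (2 * (4500 * (F.L : ℝ) ^ 2 * ε₀) + 2 * δV + 2 * δU) * ‖toL2S F K c₀ u‖
        + (Real.sqrt ((25 / 8) * (c₁ * ((((F.P K).L : ℝ) ^ (F.P K).d) ^ (K - n))⁻¹ / c₀)) * τ + Real.sqrt ((25 / 8) * (c₁ * ((((F.P K).L : ℝ) ^ (F.P K).d) ^ (K - n))⁻¹ / c₀)) * τ) := by
        rw [norm_neg]
        refine add_le_add hnear ((norm_sub_le _ _).trans (add_le_add ?_ ?_))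
        · exact hfarU.trans (mul_le_mul_of_nonneg_left htail hκ0)
        · exact hfarV.trans (mul_le_mul_of_nonneg_left htail hκ0)
    _ = _ := by ring

include hε₀ hε7 hregU hseqU hι in
/-- ★★★ **(RB2) AT THE MEMBER `(S_W, S_1)`**: the flat system of record `Q1` at `U₀ = 1` (`RegPr F n K ε₀ 1` is the consumer's ✓`regPr_one_…`) against the curved `QU` at `U` whose units
background is `δ′`-flat on the two comb walks of every `x` in a block meeting `supp χ̃` (lengths `≤ m`, `1 ≤ m`, `4mδ′ ≤ 1`; ✓`frameRow_of_walkFlat`, ✓`frameRow_one`):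
`‖ι(QU(toL2S u)) − ι(Q1(toL2S u))‖ ≤ √(2κ)·(9000L²ε₀ + 16mδ′)·‖toL2S u‖ + 2·√(25κ∕8)·τ` whenever `‖toL2S((1 − χ̃)·u)‖ ≤ τ`.
[cite: Balaban1985BackgroundPropagators, (3.16), (3.19) p.393, (3.21), (3.24) p.394; Balaban1985Averaging, (19)-(20) p.21, (97) p.32] -/
theorem norm_lift_topMean_sub_flat_le_of_tail (hreg1 : RegPr F n K ε₀ (1 : GaugeField (F.P K) 0 (Matrix.specialUnitaryGroup (Fin 2) ℂ)))
    (Q1 : SiteL2K ℂ 3 (periodsT3 F K) c₀ W₂ →ₗ[ℂ] (Site (F.P K) (K - n) → Matrix (Fin 2) (Fin 2) ℂ))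
    (hseq1 : ∀ lam : Site (F.P K) 0 → Matrix (Fin 2) (Fin 2) ℂ, ∃ ns : (j : ℕ) → Site (F.P K) j → Matrix (Fin 2) (Fin 2) ℂ, ns 0 = lam ∧
        (∀ (j : ℕ) (y : Site (F.P K) (j + 1)), ns (j + 1) y = ns j (emb y) - meanCLM (Idx (F.P K)) (Matrix (Fin 2) (Fin 2) ℂ) fun i : Idx (F.P K) =>
          ns j (emb y) - ((holT (emlIterU j (bgUnits F K (1 : GaugeField (F.P K) 0 (Matrix.specialUnitaryGroup (Fin 2) ℂ)))) (emb y) (stairWord i.2.1 (off i.1)) : (Matrix (Fin 2) (Fin 2) ℂ)ˣ) : Matrix (Fin 2) (Fin 2) ℂ) *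
            ns j (transl (emb y) (disp (stairWord i.2.1 (off i.1)))) * (((holT (emlIterU j (bgUnits F K (1 : GaugeField (F.P K) 0 (Matrix.specialUnitaryGroup (Fin 2) ℂ)))) (emb y) (stairWord i.2.1 (off i.1)))⁻¹ : (Matrix (Fin 2) (Fin 2) ℂ)ˣ) : Matrix (Fin 2) (Fin 2) ℂ)) ∧
        ns (K - n) = Q1 (toL2S F K c₀ lam))
    (χt : Site (F.P K) 0 → ℝ) (hχ1 : ∀ x, |χt x| ≤ 1) {δ' : ℝ} (hδ : 0 ≤ δ') {m : ℕ} (hm1 : 1 ≤ m) (hmδ : 4 * (m : ℝ) * δ' ≤ 1)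
    (hlen : ∀ Y : Site (F.P K) (K - n), (∃ x ∈ iterBlock (K - n) Y, χt x ≠ 0) → ∀ x ∈ iterBlock (K - n) Y,
      l1 (rel (Site.fibreSite 0 (K - n) (iterBlockOf (K - n) x) fun _ => (⟨0, pow_pos (F.P K).L_pos (K - n)⟩ : Fin ((F.P K).L ^ (K - n)))) (embIter (K - n) Y)) ≤ m ∧ l1 (rel (Site.fibreSite 0 (K - n) (iterBlockOf (K - n) x) fun _ => (⟨0, pow_pos (F.P K).L_pos (K - n)⟩ : Fin ((F.P K).L ^ (K - n)))) x) ≤ m)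
    (hw : ∀ Y : Site (F.P K) (K - n), (∃ x ∈ iterBlock (K - n) Y, χt x ≠ 0) → ∀ x ∈ iterBlock (K - n) Y,
      (∀ st ∈ walk (Site.fibreSite 0 (K - n) (iterBlockOf (K - n) x) fun _ => (⟨0, pow_pos (F.P K).L_pos (K - n)⟩ : Fin ((F.P K).L ^ (K - n)))) (treeWord (rel (Site.fibreSite 0 (K - n) (iterBlockOf (K - n) x) fun _ => (⟨0, pow_pos (F.P K).L_pos (K - n)⟩ : Fin ((F.P K).L ^ (K - n)))) (embIter (K - n) Y))), ‖((bgUnits F K U st.bond : (Matrix (Fin 2) (Fin 2) ℂ)ˣ) : Matrix (Fin 2) (Fin 2) ℂ) - 1‖ ≤ δ') ∧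
      (∀ st ∈ walk (Site.fibreSite 0 (K - n) (iterBlockOf (K - n) x) fun _ => (⟨0, pow_pos (F.P K).L_pos (K - n)⟩ : Fin ((F.P K).L ^ (K - n)))) (treeWord (rel (Site.fibreSite 0 (K - n) (iterBlockOf (K - n) x) fun _ => (⟨0, pow_pos (F.P K).L_pos (K - n)⟩ : Fin ((F.P K).L ^ (K - n)))) x)), ‖((bgUnits F K U st.bond : (Matrix (Fin 2) (Fin 2) ℂ)ˣ) : Matrix (Fin 2) (Fin 2) ℂ) - 1‖ ≤ δ'))
    (u : Site (F.P K) 0 → Matrix (Fin 2) (Fin 2) ℂ) {τ : ℝ} (htail : ‖toL2S F K c₀ (fun x => (1 - χt x) • u x)‖ ≤ τ) :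
    ‖ι (QU (toL2S F K c₀ u)) - ι (Q1 (toL2S F K c₀ u))‖
      ≤ Real.sqrt (2 * (c₁ * ((((F.P K).L : ℝ) ^ (F.P K).d) ^ (K - n))⁻¹ / c₀)) * (2 * (4500 * (F.L : ℝ) ^ 2 * ε₀) + 16 * m * δ') * ‖toL2S F K c₀ u‖
        + 2 * Real.sqrt ((25 / 8) * (c₁ * ((((F.P K).L : ℝ) ^ (F.P K).d) ^ (K - n))⁻¹ / c₀)) * τ := by
  have hδU : (0 : ℝ) ≤ 8 * m * δ' := by positivity
  have key := norm_lift_topMean_sub_le_of_tail F hε₀ hε7 (1 : GaugeField (F.P K) 0 (Matrix.specialUnitaryGroup (Fin 2) ℂ)) hreg1 Q1 hseq1 U hregU QU hseqU h ι hι χt hχ1 le_rfl hδU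
    (frameRow_one F χt) (frameRow_of_walkFlat F U χt hδ hm1 hmδ hlen hw) u htail
  have e : (2 * (4500 * (F.L : ℝ) ^ 2 * ε₀) + 2 * (0 : ℝ) + 2 * (8 * m * δ')) = 2 * (4500 * (F.L : ℝ) ^ 2 * ε₀) + 16 * m * δ' := by ring
  rw [e] at key
  exact key

end Summit.QuantumFields.YangMills.Theorems.Prop7TopMeanComparisonOnPropagator
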